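import Summits.ResolutionOfSingularities.ResolutionOfSingularities.Theorems.PurelyInseparableDim4Target
import Literature.AlgebraicGeometry.Resolution.CentreBlowupResidueInequality
import Literature.AlgebraicGeometry.Resolution.CentreBlowupOrdAlongBasics
import Literature.AlgebraicGeometry.Resolution.OrdZeroBasics
import HarnessLib
import HarnessLib.Audit.Tags

/-!
# Purely inseparable four-folds `z^p + F(x₁,…,x₄)` — what a RISE of the shade costs, I:
# Hauser–Perlega 2019 Comment (b) at `e = 1` and the jump ledger `5d + 2·NI + 2·|E|` (model level)
# [OURS · counted 0 · census brick PR-4′ of cell res-dim4-pi]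

Cell «res-dim4-pi» (D-0157 DOOR 2), desk brick **PR-4′** (boards/ROUTES.md WORD #14 (h), WORD #24
(a); crit-2 V-B-02 (iii)): "formalise HP 2019 Thm 1 (6) + comment (b) at `e = 1` for HP-permissible
COORDINATE centres over `CentreBlowup.step`, plus Lemma K".

TREE FIRST.  Assertion (6) of [HauserPerlega2019PRIMS, §3 Theorem], its Comment (d) ("at least two
components of `D` are lost"), (2), (7) and (9) are ALREADY kernel theorems for Moh/HP-permissible
coordinate centres of any dimension, every `e`, every number of variables, at the points of the fibre
over the origin: `CentreBlowup.residueInequality_of_shadeIncreases[_of_clean]`,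
`CentreBlowup.exists_two_lost_of_shadeIncreases`, `CentreBlowup.dvd_of_shadeIncreases`,
`CentreBlowup.pow_dvd_apply_of_shadeIncreases_of_kept` / `pow_dvd_r_of_shadeIncreases_of_not_mem`,
`CentreBlowup.mohBound_pow` (`Literature/…/CentreBlowupResidueInequality.lean`); "Lemma K" (the kept
components keep their multiplicities and `y^{r′} ∣ F′`) is `CentreBlowup.step_r_apply_of_ne` /
`CentreBlowup.newMult_le_of_mem_support_step` (`…/CentreBlowupMohStability.lean`).  They are CITED
here, not restated.

WHAT THIS FILE ADDS (the tree's model `CentreBlowup.CState/step` of `PointBlowupShadeCentres.lean`,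
any finite index type `σ`; `q = p`, i.e. `e = 1`; fixed coordinates; HP-permissibility =
Hauser–Perlega's conditions (1) ∧ (2) in the per-monomial form of `CentreBlowupMohStability.lean`;
points `b` of the fibre over the origin, `b_j = 0` and `b_i = 0` off `S`):

* §1 one-step bookkeeping of the exceptional set `exc` and of the count
  `NI = #{i ∈ exc : p ∤ r_i}` (census card I-2-1's "non-integral corner coordinates"): after any
  step `|exc′| ≤ |exc| + 1`, `NI′ ≤ NI + 1`; if the newborn multiplicity is `≡ 0 (mod p)` and two
  components of `exc` with `p ∤ r_i` are lost, then `NI′ + 2 ≤ NI` and `|exc′| + 1 ≤ |exc|`;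
  `supp r ⊆ exc` is preserved.
* §2 **Comment (b) at `e = 1`** (`dvd_step_r_self_of_shadeIncreases`): at an increase of the shade
  under an HP-permissible coordinate centre the NEWBORN component's multiplicity
  `r′_j = ord_{C_S} F − p` is divisible by `p` — from (2) (`p ∣ ord₀ F`), (7) off the centre
  (`p ∣ r_i`, `i ∉ S`) and `ord_{C_S} F = degIn_S r + shade` (`CentreBlowup.ordAlong_eq_of_perm`);
  and the jump certificate (card I-2-1 (D)). [cite: HauserPerlega2019PRIMS, §3 Comment (b)]
* §3 **the jump ledger** of census card I-2-1 (res-dim4-idea-2; verdicts crit-1 V-A-02 / crit-2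
  V-B-02: "KNOWN = refinement of HP (6)(b)(d) + Moh, alive as CHECKSUM") as kernel theorems in ℕ:
  (A) RISE ⇒ `5d′ + 2NI′ + 2|exc′| + 1 ≤ 5d + 2NI + 2|exc|` on the population "HP-permissible
  coordinate centre, chart `j ∈ S`, point of the fibre over the origin, cleaned state with `y^r ∣ F`
  and `supp r ⊆ exc`"; (B) DROP ⇒ the same inequality for EVERY centre, chart and point.
  Ingredients: Moh's `d′ ≤ d + 1` (`CentreBlowup.mohBound_one`), Comment (d) (tree), §2, §1.
  The cell-vocabulary (`PIDim4.State`, `Perm2`, `RiseD`, `Edge`) ℕ∞ forms are the sequel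
  `PurelyInseparableDim4JumpLedger.lean`.

HONEST SCOPE.  Points translated ALONG the centre (`b_i ≠ 0` for some `i ∉ S`) are NOT covered (the
reduction to the fibre is brick PR-1 of the cell); `e ≥ 2` is not covered (there (b) reads
`p^e ∣ r′_j` and no ledger is claimed: HP's cycles live there); nothing here is a statement about
resolution of singularities — census value only.  Resolution of singularities in dimension ≥ 4 /
characteristic `p` is NOT proved anywhere in this programme; counted 0; AI formalisation, weaker
than expert review.

bears_on: LADDER-RESOLUTION:D157-DOOR2 (res-dim4-pi · PR-4′). Supports stmt-ResolutionOfSingularities-16155 (helper).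
-/

set_option linter.dupNamespace false

noncomputable section

open MvPolynomial Finset

open scoped BigOperators

namespace Summit.ResolutionOfSingularities.ResolutionOfSingularities.Theorems.PIDim4.KangarooLoss

open Literature.AlgebraicGeometry.Resolution
open Literature.AlgebraicGeometry.Resolution.Hauser2010
open Literature.AlgebraicGeometry.Resolution.CentreBlowup

/-! ## 1. One-step bookkeeping of `exc` and of `NI = #{i ∈ exc : p ∤ r_i}` (any index type) -/

section Bookkeeping

variable {σ : Type*} {K : Type*} [Field K] [DecidableEq σ] [DecidableEq K]

/-- The new exceptional set: the newborn `j` and the old components the point stays on.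
[cite: Hauser2010, §F (transform D')] -/
theorem step_exc (q : ℕ) (S : Finset σ) (j : σ) (b : σ → K) (s : CState σ K) :
    (step q S j b s).exc = insert j (s.exc.filter fun i => b i = 0) := rfl

/-- Membership in the new exceptional set. [cite: Hauser2010, §F (transform D')] -/
theorem mem_step_exc_iff (q : ℕ) (S : Finset σ) (j : σ) (b : σ → K) (s : CState σ K) {i : σ} :
    i ∈ (step q S j b s).exc ↔ i = j ∨ (i ∈ s.exc ∧ b i = 0) := by
  rw [step_exc, Finset.mem_insert, Finset.mem_filter]

/-- The multiplicity of an OLD component after the step: kept (`b_i = 0`) components keep `r_i`,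
translated ones lose it ("Lemma K" of the cell, bookkeeping half; the divisibility half
`y^{r′} ∣ F′` is `CentreBlowup.newMult_le_of_mem_support_step`). [cite: Hauser2010, §F (transform D')] -/
theorem step_r_apply_of_ne' (q : ℕ) (S : Finset σ) {j i : σ} (hij : i ≠ j) (b : σ → K)
    (s : CState σ K) : (step q S j b s).r i = if b i = 0 then s.r i else 0 := by
  rw [step_r_apply_of_ne q S hij b s]
  show PointBlowup.newMult q j b s.toState i = _
  unfold PointBlowup.newMult
  rw [Finsupp.update_apply, if_neg hij, Finsupp.filter_apply]
  rfl

/-- `|exc′| ≤ |exc| + 1` after any step. [folklore] -/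
theorem card_step_exc_le (q : ℕ) (S : Finset σ) (j : σ) (b : σ → K) (s : CState σ K) :
    (step q S j b s).exc.card ≤ s.exc.card + 1 := by
  rw [step_exc]
  have h1 := Finset.card_insert_le j (s.exc.filter fun i => b i = 0)
  have h2 := Finset.card_filter_le s.exc (fun i => b i = 0)
  omega

/-- After any step the components with `p ∤ r′_i` are among the newborn `j` and the old components
with `p ∤ r_i`. [folklore] -/
theorem filter_step_exc_subset (p q : ℕ) (S : Finset σ) (j : σ) (b : σ → K) (s : CState σ K) :
    ((step q S j b s).exc.filter fun i => ¬ p ∣ (step q S j b s).r i) ⊆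
      insert j (s.exc.filter fun i => ¬ p ∣ s.r i) := by
  intro i hi
  rw [Finset.mem_filter, mem_step_exc_iff] at hi
  obtain ⟨hmem, hndvd⟩ := hi
  rw [Finset.mem_insert, Finset.mem_filter]
  by_cases hij : i = j
  · exact Or.inl hij
  · right
    rcases hmem with h | ⟨hexc, hbi⟩
    · exact (hij h).elim
    · rw [step_r_apply_of_ne' q S hij b s, if_pos hbi] at hndvd
      exact ⟨hexc, hndvd⟩

/-- `NI′ ≤ NI + 1` after any step. [folklore] -/
theorem card_filter_step_le (p q : ℕ) (S : Finset σ) (j : σ) (b : σ → K) (s : CState σ K) :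
    ((step q S j b s).exc.filter fun i => ¬ p ∣ (step q S j b s).r i).card ≤
      (s.exc.filter fun i => ¬ p ∣ s.r i).card + 1 :=
  (Finset.card_le_card (filter_step_exc_subset p q S j b s)).trans (Finset.card_insert_le _ _)

/-- If the newborn multiplicity is divisible by `p`, the components with `p ∤ r′_i` after the step
are old, kept, different from `j`, with `p ∤ r_i`. [folklore] -/
theorem filter_step_exc_subset_of_dvd (p q : ℕ) (S : Finset σ) (j : σ) (b : σ → K)
    (s : CState σ K) (hdvdj : p ∣ (step q S j b s).r j) :
    ((step q S j b s).exc.filter fun i => ¬ p ∣ (step q S j b s).r i) ⊆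
      (s.exc.filter fun i => ¬ p ∣ s.r i ∧ b i = 0 ∧ i ≠ j) := by
  intro i hi
  rw [Finset.mem_filter, mem_step_exc_iff] at hi
  obtain ⟨hmem, hndvd⟩ := hi
  have hij : i ≠ j := fun h => hndvd (h ▸ hdvdj)
  rcases hmem with h | ⟨hexc, hbi⟩
  · exact (hij h).elim
  rw [step_r_apply_of_ne' q S hij b s, if_pos hbi] at hndvd
  exact Finset.mem_filter.mpr ⟨hexc, hndvd, hbi, hij⟩

/-- **`NI′ + 2 ≤ NI`** when the newborn multiplicity is `≡ 0 (mod p)`, `supp r ⊆ exc`, and two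
distinct components with `p ∤ r_i` are lost (each is the chart's or translated).
[cite: HauserPerlega2019PRIMS, §3 Comment (d)] -/
theorem card_filter_step_add_two_le (p q : ℕ) (S : Finset σ) (j : σ) (b : σ → K)
    (s : CState σ K) (hdvdj : p ∣ (step q S j b s).r j) (hexc : ∀ i, s.r i ≠ 0 → i ∈ s.exc)
    {i₁ i₂ : σ} (hne : i₁ ≠ i₂) (hl₁ : i₁ = j ∨ b i₁ ≠ 0) (hl₂ : i₂ = j ∨ b i₂ ≠ 0)
    (hr₁ : ¬ p ∣ s.r i₁) (hr₂ : ¬ p ∣ s.r i₂) :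
    ((step q S j b s).exc.filter fun i => ¬ p ∣ (step q S j b s).r i).card + 2 ≤
      (s.exc.filter fun i => ¬ p ∣ s.r i).card := by
  set N := s.exc.filter fun i => ¬ p ∣ s.r i with hN
  have hsub := filter_step_exc_subset_of_dvd p q S j b s hdvdj
  have hi₁N : i₁ ∈ N :=
    Finset.mem_filter.mpr ⟨hexc i₁ (fun h => hr₁ (h ▸ dvd_zero p)), hr₁⟩
  have hi₂N : i₂ ∈ N :=
    Finset.mem_filter.mpr ⟨hexc i₂ (fun h => hr₂ (h ▸ dvd_zero p)), hr₂⟩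
  have hsub' : (s.exc.filter fun i => ¬ p ∣ s.r i ∧ b i = 0 ∧ i ≠ j) ⊆ (N.erase i₁).erase i₂ := by
    intro i hi
    obtain ⟨hexci, hndvd, hbi, hij⟩ := Finset.mem_filter.mp hi
    rw [Finset.mem_erase, Finset.mem_erase]
    refine ⟨fun h => ?_, fun h => ?_, Finset.mem_filter.mpr ⟨hexci, hndvd⟩⟩
    · subst h
      rcases hl₂ with h2 | h2
      · exact hij h2
      · exact h2 hbi
    · subst h
      rcases hl₁ with h1 | h1
      · exact hij h1
      · exact h1 hbi
  have hi₂' : i₂ ∈ N.erase i₁ := Finset.mem_erase.mpr ⟨hne.symm, hi₂N⟩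
  have hc₁ := Finset.card_erase_of_mem hi₁N
  have hc₂ := Finset.card_erase_of_mem hi₂'
  have hpos₁ : 0 < N.card := Finset.card_pos.mpr ⟨i₁, hi₁N⟩
  have hpos₂ : 0 < (N.erase i₁).card := Finset.card_pos.mpr ⟨i₂, hi₂'⟩
  have hle := Finset.card_le_card (hsub.trans hsub')
  omega

/-- **`|exc′| + 1 ≤ |exc|`** when two distinct components of `exc` are lost at the step (each is the
chart's — replaced by the newborn one — or translated). [cite: HauserPerlega2019PRIMS, §3 Comment (d)] -/
theorem card_step_exc_add_one_le (q : ℕ) (S : Finset σ) (j : σ) (b : σ → K) (s : CState σ K)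
    (hbj : b j = 0) {i₁ i₂ : σ} (hne : i₁ ≠ i₂) (hl₁ : i₁ = j ∨ b i₁ ≠ 0)
    (hl₂ : i₂ = j ∨ b i₂ ≠ 0) (he₁ : i₁ ∈ s.exc) (he₂ : i₂ ∈ s.exc) :
    (step q S j b s).exc.card + 1 ≤ s.exc.card := by
  rw [step_exc]
  set F0 := s.exc.filter fun i => b i = 0 with hF0
  -- a translated component of `exc` is missing from `F0`
  have herase : ∀ i, b i ≠ 0 → F0 ⊆ s.exc.erase i := fun i hbi k hk => by
    obtain ⟨hk1, hk2⟩ := Finset.mem_filter.mp hk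
    exact Finset.mem_erase.mpr ⟨fun h => hbi (h ▸ hk2), hk1⟩
  rcases hl₁ with h₁ | hb₁
  · subst h₁
    have hjF0 : i₁ ∈ F0 := Finset.mem_filter.mpr ⟨he₁, hbj⟩
    rw [Finset.insert_eq_of_mem hjF0]
    have hb₂ : b i₂ ≠ 0 := by
      rcases hl₂ with h | h
      · exact (hne h.symm).elim
      · exact h
    have hle := Finset.card_le_card (herase i₂ hb₂)
    rw [Finset.card_erase_of_mem he₂] at hle
    have hpos : 0 < s.exc.card := Finset.card_pos.mpr ⟨i₂, he₂⟩
    omega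
  rcases hl₂ with h₂ | hb₂
  · subst h₂
    have hjF0 : i₂ ∈ F0 := Finset.mem_filter.mpr ⟨he₂, hbj⟩
    rw [Finset.insert_eq_of_mem hjF0]
    have hle := Finset.card_le_card (herase i₁ hb₁)
    rw [Finset.card_erase_of_mem he₁] at hle
    have hpos : 0 < s.exc.card := Finset.card_pos.mpr ⟨i₁, he₁⟩
    omega
  · have hsub : F0 ⊆ (s.exc.erase i₁).erase i₂ := fun k hk => by
      obtain ⟨hk1, hk2⟩ := Finset.mem_filter.mp hk
      rw [Finset.mem_erase, Finset.mem_erase]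
      exact ⟨fun h => hb₂ (h ▸ hk2), fun h => hb₁ (h ▸ hk2), hk1⟩
    have hi₂' : i₂ ∈ s.exc.erase i₁ := Finset.mem_erase.mpr ⟨hne.symm, he₂⟩
    have hc₁ := Finset.card_erase_of_mem he₁
    have hc₂ := Finset.card_erase_of_mem hi₂'
    have hpos₁ : 0 < s.exc.card := Finset.card_pos.mpr ⟨i₁, he₁⟩
    have hpos₂ : 0 < (s.exc.erase i₁).card := Finset.card_pos.mpr ⟨i₂, hi₂'⟩
    have hle := Finset.card_le_card hsub
    have hins := Finset.card_insert_le j F0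
    omega

/-- `supp r ⊆ exc` is preserved by every step (so it is an invariant of the walk from any root with
`exc ⊇ supp r`). [folklore] -/
theorem mem_step_exc_of_step_r_ne_zero (q : ℕ) (S : Finset σ) (j : σ) (b : σ → K)
    (s : CState σ K) (hexc : ∀ i, s.r i ≠ 0 → i ∈ s.exc) :
    ∀ i, (step q S j b s).r i ≠ 0 → i ∈ (step q S j b s).exc := by
  intro i hi
  rw [mem_step_exc_iff]
  by_cases hij : i = j
  · exact Or.inl hij
  · rw [step_r_apply_of_ne' q S hij b s] at hi
    by_cases hbi : b i = 0
    · rw [if_pos hbi] at hi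
      exact Or.inr ⟨hexc i hi, hbi⟩
    · rw [if_neg hbi] at hi
      exact (hi rfl).elim

end Bookkeeping

/-! ## 2. Comment (b) at `e = 1`: the newborn multiplicity is `≡ 0 (mod p)` at a rise -/

section Newborn

variable {σ : Type*} {K : Type*} [Field K] [Fintype σ] [DecidableEq σ] [DecidableEq K]
variable (p : ℕ) [hp : Fact p.Prime] [CharP K p]

/-- **[HP19 PRIMS] Comment (b) at `e = 1`, for HP-permissible coordinate centres of any dimension.**
Let `s = (F, r, exc)` be a state with `y^r ∣ F`, `C_S` a coordinate centre with `j ∈ S` which is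
HP-permissible (every monomial `y^d` of `F` has `degIn S d ≥ p` — condition (1) — and
`degIn S d ≥ degIn S r + shade` — condition (2)), and `b` a point of the fibre over the origin of the
`y_j`-chart (`b_j = 0`, `b_i = 0` off `S`) at which the shade INCREASES.  Then the multiplicity of the
newborn exceptional component, `r′_j = ord_{C_S} F − p`, is divisible by `p` ("The multiplicity of
the new exceptional component in `D′` equals `ord_P 𝒦 − c!` and is hence a multiple of `c!`", read
for `c = p`, `e = 1`, in `F`-units).  Proof: `ord_{C_S} F = degIn S r + shade = ord₀F − Σ_{i∉S} r_i`
(`ordAlong_eq_of_perm`), `p ∣ ord₀ F` ((2), `dvd_of_shadeIncreases`) and `p ∣ r_i` for `i ∉ S`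
((7) off the centre, `pow_dvd_r_of_shadeIncreases_of_not_mem`).
[cite: HauserPerlega2019PRIMS, §3 Comment (b)] -/
theorem dvd_step_r_self_of_shadeIncreases {S : Finset σ} {j : σ} (hj : j ∈ S) (b : σ → K)
    (hbj : b j = 0) (hbN : ∀ i, i ∉ S → b i = 0) (s : CState σ K) {o : ℕ}
    (ho : ordZero s.F = o) (hr : ∀ d ∈ s.F.support, s.r ≤ d)
    (hq : ∀ d ∈ s.F.support, p ≤ degIn S d)
    (hperm : ∀ d ∈ s.F.support, degIn S s.r + (o - s.r.degree) ≤ degIn S d)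
    (hinc : ShadeIncreases p S j b s) : p ∣ (step p S j b s).r j := by
  have hpo : p ∣ o := dvd_of_shadeIncreases p hj b hbj hbN s ho hr hq hperm hinc
  have hq1 : ∀ d ∈ s.F.support, p ^ 1 ≤ degIn S d := fun d hd => by
    rw [pow_one]; exact hq d hd
  have hinc1 : ShadeIncreases (p ^ 1) S j b s := by rw [pow_one]; exact hinc
  have hoff : ∀ i, i ∉ S → p ∣ s.r i := fun i hi => by
    have h := pow_dvd_r_of_shadeIncreases_of_not_mem p hj b hbj hbN s ho hr hq1 hperm hinc1 hi
    rwa [pow_one] at h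
  have hsum : p ∣ ∑ i ∈ Sᶜ, s.r i :=
    Finset.dvd_sum fun i hi => hoff i (Finset.mem_compl.mp hi)
  have hsplit := degIn_add_sum_compl S s.r
  obtain ⟨-, -, hro⟩ := le_of_forall_le_degIn S s ho hr hperm hq
  rw [step_r_eq p S j b hbj s ho hr hperm, Finsupp.filter_apply, if_pos hbj, Finsupp.update_apply,
    if_pos rfl]
  have h1 : degIn S s.r + (o - s.r.degree) = o - ∑ i ∈ Sᶜ, s.r i := by omega
  rw [h1]
  exact Nat.dvd_sub (Nat.dvd_sub hpo hsum) (dvd_refl p)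

/-- **Jump certificate (card I-2-1 (D)) at `e = 1`**, fibre-over-the-origin points of HP-permissible
coordinate centres: at an increase of the shade, `p ∣ ord₀ F`, the newborn multiplicity is
`≡ 0 (mod p)`, every variable carrying a non-`p`-divisible exponent in an initial monomial is LOST
(the chart's or translated: `Act_p(in F) ⊆ T`), and — if `supp r ⊆ exc` and the state is cleaned —
`NI′ + 2 ≤ NI`. [cite: HauserPerlega2019PRIMS, §3 Theorem (2), (6), (7) and Comments (b), (d)] -/
theorem jumpCertificate_of_shadeIncreases {S : Finset σ} {j : σ} (hj : j ∈ S) (b : σ → K)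
    (hbj : b j = 0) (hbN : ∀ i, i ∉ S → b i = 0) (s : CState σ K)
    (hclean : deletePthPowers p s.F = s.F) {o : ℕ} (ho : ordZero s.F = o)
    (hr : ∀ d ∈ s.F.support, s.r ≤ d) (hexc : ∀ i, s.r i ≠ 0 → i ∈ s.exc)
    (hq : ∀ d ∈ s.F.support, p ≤ degIn S d)
    (hperm : ∀ d ∈ s.F.support, degIn S s.r + (o - s.r.degree) ≤ degIn S d)
    (hinc : ShadeIncreases p S j b s) :
    p ∣ o ∧ p ∣ (step p S j b s).r j ∧
      (∀ d ∈ s.F.support, d.degree = o → ∀ i, ¬ p ∣ d i → i = j ∨ b i ≠ 0) ∧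
      ((step p S j b s).exc.filter fun i => ¬ p ∣ (step p S j b s).r i).card + 2 ≤
        (s.exc.filter fun i => ¬ p ∣ s.r i).card := by
  have hq1 : ∀ d ∈ s.F.support, p ^ 1 ≤ degIn S d := fun d hd => by
    rw [pow_one]; exact hq d hd
  have hinc1 : ShadeIncreases (p ^ 1) S j b s := by rw [pow_one]; exact hinc
  have hclean1 : deletePthPowers (p ^ 1) s.F = s.F := by rw [pow_one]; exact hclean
  have hdvdj := dvd_step_r_self_of_shadeIncreases p hj b hbj hbN s ho hr hq hperm hinc
  refine ⟨dvd_of_shadeIncreases p hj b hbj hbN s ho hr hq hperm hinc, hdvdj, ?_, ?_⟩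
  · intro d hd hddeg i hndvd
    by_cases hij : i = j
    · exact Or.inl hij
    · right
      intro hbi
      have h := pow_dvd_apply_of_shadeIncreases_of_kept p hj b hbj hbN s ho hr hq1 hperm hinc1 hij
        hbi hd hddeg
      rw [pow_one] at h
      exact hndvd h
  · obtain ⟨i₁, i₂, hne, hl₁, hl₂, hr₁, hr₂⟩ :=
      exists_two_lost_of_shadeIncreases p le_rfl hj b hbj hbN s hclean1 ho hr hq1 hperm hinc1
    rw [pow_one] at hr₁ hr₂
    exact card_filter_step_add_two_le p p S j b s hdvdj hexc hne hl₁ hl₂ hr₁ hr₂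

end Newborn

/-! ## 3. The jump ledger `5·d + 2·NI + 2·|exc|` (card I-2-1 (A), (B)) in natural numbers -/

section Ledger

variable {σ : Type*} {K : Type*} [Field K] [Fintype σ] [DecidableEq σ] [DecidableEq K]
variable (p : ℕ) [hp : Fact p.Prime] [CharP K p]

omit [Fintype σ] hp [CharP K p] in
/-- **(B) DROP pays**: if the shade drops at a step (any centre `S`, chart `j`, point `b`), then
`5d′ + 2NI′ + 2|exc′| + 1 ≤ 5d + 2NI + 2|exc|` (`d = ord₀F − |r|` the shade): `d′ ≤ d − 1`,
`NI′ ≤ NI + 1`, `|exc′| ≤ |exc| + 1`. [folklore] -/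
theorem ledger_of_shade_lt (q : ℕ) (S : Finset σ) (j : σ) (b : σ → K) (s : CState σ K)
    {o o' : ℕ} (ho : ordZero s.F = o) (ho' : ordZero (step q S j b s).F = o')
    (hdrop : (step q S j b s).shade < s.shade) :
    5 * (o' - (step q S j b s).r.degree) +
        2 * ((step q S j b s).exc.filter fun i => ¬ p ∣ (step q S j b s).r i).card +
        2 * (step q S j b s).exc.card + 1 ≤
      5 * (o - s.r.degree) + 2 * (s.exc.filter fun i => ¬ p ∣ s.r i).card + 2 * s.exc.card := by
  have h1 := card_filter_step_le p q S j b s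
  have h2 := card_step_exc_le q S j b s
  rw [CState.shade_eq_of_ordZero_eq _ ho, CState.shade_eq_of_ordZero_eq _ ho'] at hdrop
  have h3 : o' - (step q S j b s).r.degree < o - s.r.degree := by exact_mod_cast hdrop
  omega

/-- **(A) a RISE is paid for**, at `e = 1`, at the points of the fibre over the origin of an
HP-permissible coordinate centre of any dimension: for a cleaned state with `y^r ∣ F` and
`supp r ⊆ exc`, an increase of the shade forces `5d′ + 2NI′ + 2|exc′| + 1 ≤ 5d + 2NI + 2|exc|` —
Moh's `d′ ≤ d + 1` (`CentreBlowup.mohBound_one`) costs `5`, the two lost components with `p ∤ r_i`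
(Comment (d)) and the `p`-divisible newborn multiplicity (Comment (b)) refund `2·2 + 2·1 = 6`.
[cite: HauserPerlega2019PRIMS, §3 Theorem (6), (9) and Comments (b), (d)] [cite: Moh1987, Stability Theorem (p. 966)] -/
theorem ledger_of_shadeIncreases {S : Finset σ} {j : σ} (hj : j ∈ S) (b : σ → K) (hbj : b j = 0)
    (hbN : ∀ i, i ∉ S → b i = 0) (s : CState σ K) (hclean : deletePthPowers p s.F = s.F)
    {o o' : ℕ} (ho : ordZero s.F = o) (ho' : ordZero (step p S j b s).F = o')
    (hr : ∀ d ∈ s.F.support, s.r ≤ d) (hexc : ∀ i, s.r i ≠ 0 → i ∈ s.exc)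
    (hq : ∀ d ∈ s.F.support, p ≤ degIn S d)
    (hperm : ∀ d ∈ s.F.support, degIn S s.r + (o - s.r.degree) ≤ degIn S d)
    (hinc : ShadeIncreases p S j b s) :
    5 * (o' - (step p S j b s).r.degree) +
        2 * ((step p S j b s).exc.filter fun i => ¬ p ∣ (step p S j b s).r i).card +
        2 * (step p S j b s).exc.card + 1 ≤
      5 * (o - s.r.degree) + 2 * (s.exc.filter fun i => ¬ p ∣ s.r i).card + 2 * s.exc.card := by
  have hM := mohBound_one p hj b hbj hbN s hclean ho hr hq hperm
  rw [CState.shade_eq_of_ordZero_eq _ ho, CState.shade_eq_of_ordZero_eq _ ho'] at hM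
  have hM' : o' - (step p S j b s).r.degree ≤ o - s.r.degree + 1 := by exact_mod_cast hM
  have hq1 : ∀ d ∈ s.F.support, p ^ 1 ≤ degIn S d := fun d hd => by
    rw [pow_one]; exact hq d hd
  have hinc1 : ShadeIncreases (p ^ 1) S j b s := by rw [pow_one]; exact hinc
  have hclean1 : deletePthPowers (p ^ 1) s.F = s.F := by rw [pow_one]; exact hclean
  obtain ⟨i₁, i₂, hne, hl₁, hl₂, hr₁, hr₂⟩ :=
    exists_two_lost_of_shadeIncreases p le_rfl hj b hbj hbN s hclean1 ho hr hq1 hperm hinc1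
  rw [pow_one] at hr₁ hr₂
  have he₁ : i₁ ∈ s.exc := hexc i₁ (fun h => hr₁ (h ▸ dvd_zero p))
  have he₂ : i₂ ∈ s.exc := hexc i₂ (fun h => hr₂ (h ▸ dvd_zero p))
  have hdvdj := dvd_step_r_self_of_shadeIncreases p hj b hbj hbN s ho hr hq hperm hinc
  have hNI := card_filter_step_add_two_le p p S j b s hdvdj hexc hne hl₁ hl₂ hr₁ hr₂
  have hE := card_step_exc_add_one_le p S j b s hbj hne hl₁ hl₂ he₁ he₂
  omega

end Ledger

end Summit.ResolutionOfSingularities.ResolutionOfSingularities.Theorems.PIDim4.KangarooLoss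

end
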